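import Literature.Analysis.FluidPDE.DeRosaIterativeSchemeHolds
import Literature.Analysis.FluidPDE.DeRosaTimeRegularityProofs
import HarnessLib

/-!
# De Rosa 2019, Thm. 2.1 holds: weak solutions of the fractional Navier–Stokes equations with
# prescribed kinetic energy (discharge of `DeRosa2019_thm21`)

Analysis/FluidPDE proof file (theorems only; no definitions, no named facts), sibling of
`FractionalNSPrescribedEnergy.lean`, discharging the named fact
`Literature.Analysis.FluidPDE.DeRosa2019_thm21` — L. De Rosa, *Infinitely many Leray–Hopf
solutions for the fractional Navier–Stokes equations*, Comm. PDE 44 (2019) 335–365 =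
arXiv:1801.10235, §2 **Thm. 2.1** (p. 4 of the arXiv text): for `0 < γ < β < 1/3` (the printed
"β < γ" is a misprint, see the docstring of the fact) and every smooth strictly positive energy
profile `e` on `[0, T]` there are a viscosity and infinitely many weak solutions
`v ∈ C^β` of the fractional Navier–Stokes equations `∂ₜv + div(v ⊗ v) + ∇p + ν(-Δ)^γ v = 0` on
`T³ × [0, T]` with `∫|v(x,t)|² dx = e(t)`, sharing the initial datum.

The printed proof (§4.2) runs the convex-integration scheme of Prop. 4.1 from the zero triple
after rescaling, passes to the uniform limit, reads off the energy identity and the Hölder bound,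
and upgrades the time regularity. Every piece is proved in the tree:

* `DeRosa.iterativeSchemeLT_holds` (`DeRosaIterativeSchemeHolds.lean`) — Prop. 4.1 iterated from
  zero in the regime `γ < β` of the printed proof, from the three stages of §5: mollification
  (`DeRosa.mollificationStage_holds`), gluing (`DeRosa.gluingStage_holds`,
  `FracNSShortTimeExistence.lean`: short-time smooth solutions of the fractional Navier–Stokes
  equations by the Fourier–Galerkin energy method, Thm. 3.4 / Prop. 3.5, the transport and
  stability estimates of §3.1 / §5.2, the vector potentials of Prop. 5.4, the glued triple of
  Prop. 5.5 with the commutator estimate `BDSV.commutatorCZBound_holds`) and perturbation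
  (`DeRosa.perturbationStage_holds`, §§5.3–5.5);
* `DeRosa.timeRegularity_holds` (`DeRosaTimeRegularityProofs.lean`) — the last paragraph of
  §4.2 (time regularity of `C⁰_t C^{β'}_x` weak solutions);
* `DeRosa2019_thm21_of_iterativeSchemeLT_of_timeRegularity` (`DeRosaSchemeProofs.lean`) — the
  assembly of §4.2 (rescaling `ṽ(x,t) = μ v(x, μt)`, `μ = δ₁^{1/2}`, iteration, uniform limit,
  interpolation, energy identity, same initial data by the time-zero clause of Prop. 4.1).

Hence `DeRosa2019_thm21_holds`; its trust base is Mathlib's (`propext`, `Classical.choice`,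
`Quot.sound`).

## References

* L. De Rosa, *Infinitely many Leray–Hopf solutions for the fractional Navier–Stokes equations*,
  Comm. PDE 44 (2019) 335–365, doi:10.1080/03605302.2018.1547745 = arXiv:1801.10235: §2
  Thm. 2.1; §3 (Thm. 3.1, Props. 3.2–3.3, Thm. 3.4, Prop. 3.5); §4 Prop. 4.1 and §4.2 (proof of
  Thm. 2.1); §5 (proof of Prop. 4.1); §7 Thm. 7.1. [`Derosa2018`]
* T. Buckmaster, C. De Lellis, L. Székelyhidi Jr., V. Vicol, *Onsager's conjecture for admissible
  weak solutions*, CPAM 72 (2019) 229–274 = arXiv:1701.08678 (the scheme being adapted; App. D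
  Prop. D.1). [`BuckmasterEtAl2018`]
* A. J. Majda, A. L. Bertozzi, *Vorticity and Incompressible Flow*, CUP 2002, §3.2 Thm. 3.4 (the
  energy method behind Thm. 3.4). [`MajdaBertozziCUP2002`]
-/

namespace Literature.Analysis.FluidPDE

/-- **De Rosa 2019, Thm. 2.1 holds** (discharge of the named fact `DeRosa2019_thm21`,
`FractionalNSPrescribedEnergy.lean`): for `0 < γ < β < 1/3`, `T > 0` and a smooth strictly
positive energy profile `e` on `[0, T]` there is `ν > 0` and an infinite family of weak solutions
of the fractional Navier–Stokes equations on `T³ × [0, T]` in `C^β`, all with kinetic energy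
`e(t)` at every time and the same initial datum. Proof: §4.2 of the paper
(`DeRosa2019_thm21_of_iterativeSchemeLT_of_timeRegularity`) fed with the discharged iteration
`DeRosa.iterativeSchemeLT_holds` (Prop. 4.1 from zero, via the three stages of §5) and the
discharged time-regularity step `DeRosa.timeRegularity_holds`.
[cite: Derosa2018, §2 Thm. 2.1; proof §4.2 with Prop. 4.1 (§4.1) and §5] -/
theorem DeRosa2019_thm21_holds : DeRosa2019_thm21 :=
  DeRosa2019_thm21_of_iterativeSchemeLT_of_timeRegularity DeRosa.iterativeSchemeLT_holds
    DeRosa.timeRegularity_holds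

end Literature.Analysis.FluidPDE
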